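import Summits.QuantumAdvantage.AdviceFreeQNC0.NPGamma37Span
import HarnessLib

/-!
# Cell qa-qnc0 — rung (NP-Γ) `RingHardSparse3` (sparse-coupling hardness at `p = 3`, any degree): Part III-c — row data, the explicit character family of a slice, the slice expansion (E′).

Planner qa-qnc0-p2 gen 34 (INBOX P2-34c/P2-34d, memo HOME/qa-qnc0-p2/ROUND-34P2.md §4.4); split of the kernel-checked
monolith `HOME/qa-qnc0-p2/line34/NPGammaProof37.lean` (rc 0, 0 sorries, axioms propext/Classical.choice/Quot.sound) into
≤ 400-line parts `NPGamma37{Slicing,Span,Family,Assembly,Sparse}.lean`.  Part I (𝔽₄ Kraft + sparsity) and the 𝔽₄/ℤ₃ algebra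
are IMPORTED from the landed (NP₁) files `AffBells37{Kraft,Sparse,Resonance}`, Part II (the insulator-involution resonance
MGF (R′)) from the landed `Resonance37G` — identical declarations, opened by name below.

THIS FILE: `rows`/`coefs` of a slice and `sliceExpansion`: on a slice the win indicator is an explicit cube-restricted character sum.

THEOREM (NP-Γ, file `NPGamma37Sparse`): for `n ≥ 200`, every strategy `P : Fin n → CubeFn (ZMod 3) n` with all outputs in
`span {mono S : S ∈ 𝓢}`, `𝓢` admitting `8·log₂ n` insulated windows (`NPGamma37.InsulatedWindows`), satisfies
`#{x odd : Rel x (P · x = 1)} ≤ (1 − n^{−6})·2^{n−1}` — no degree hypothesis.  Supports crux stmt-QuantumAdvantage-22907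
(dense coupling — the residual core of `RingHardOdd 3` — is NOT touched).
-/

noncomputable section

namespace Summit.QuantumAdvantage.AdviceFreeQNC0.NPGamma37Proof

open Finset F4
open Classical
open Summit.QuantumAdvantage.AdviceFreeQNC0.AffBells37 (expo chiZ exists_ne_one_of_mass_lt ev L sparse sparse_ne_one
  two_pow_L_le ωz ωz_zero ωz_add ωz_natCast ωz_sq lin chiZ_eq_ωz lin_add lin_mul lin_single ιF_xor ιF_decide_eq_zero
  ιF_eq_omega ιF_ringWinU)
open Summit.QuantumAdvantage.AdviceFreeQNC0.Resonance37G (four_orbit_le orbit_mgf sg bt sg_not slope_eq no_three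
  blockCpl blockCpl_blockCpl blockCpl_involutive blockCpl_apply_of_not_mem uExt_blockCpl xN xN_eq_xOfU xN_blockCpl_of_ne
  xN_blockCpl_left xN_blockCpl_right Inv letter resonance_windows)
-- `wt` (weight of a cube-restricted character) is written `AffBells37.wt` throughout: the bare name would resolve to the
-- walk-word weight `Summit.QuantumAdvantage.AdviceFreeQNC0.wt` of `Elimination.lean`.

variable {F : ℕ}

section Slicing

open Literature.Computability.QuantumComplexity Literature.Computability.QuantumComplexity.RingHLF
open Literature.Computability.MetaComplexity
open AffBells23 AffBells26

variable {n : ℕ}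
variable {N : ℕ}

/-! ### Row data of a slice -/

/-- changing one letter lowers the weight by at most one. -/
theorem wt_le_of_eq_off (A B : Fin F → ZMod 3) (j : Fin F) (h : ∀ i, i ≠ j → B i = A i) :
    AffBells37.wt A ≤ AffBells37.wt B + 1 := by
  unfold AffBells37.wt
  calc (univ.filter fun i => A i ≠ 0).card
      ≤ ((univ.filter fun i => B i ≠ 0) ∪ {j}).card := by
        refine card_le_card fun i hi => ?_
        rw [mem_filter] at hi
        rw [mem_union, mem_filter, mem_singleton]
        by_cases hij : i = j
        · exact Or.inr hij
        · exact Or.inl ⟨mem_univ _, by rw [h i hij]; exact hi.2⟩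
    _ ≤ (univ.filter fun i => B i ≠ 0).card + ({j} : Finset (Fin F)).card := card_union_le _ _
    _ = _ := by rw [card_singleton]

/-- adding a single letter `1` at `j` lowers the weight by at most one. -/
theorem wt_add_single_ge (A : Fin F → ZMod 3) (j : Fin F) :
    AffBells37.wt A ≤ AffBells37.wt (A + Pi.single j (1 : ZMod 3)) + 1 :=
  wt_le_of_eq_off A _ j fun i hi => by rw [Pi.add_apply, Pi.single_eq_of_ne hi, add_zero]

/-- the slice constants: walk label exponent `E_g(a) = n+2+g+e_g(a)` and test value `D_g(a) = P_g(x(a)) − 1`. -/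
def Eg (a : Fin n → Bool) (g : Fin (n + 1)) : ZMod 3 := ((n + 2 + g.val + walkExp a g.val : ℕ) : ZMod 3)
/-- the test value `D_g(a) = P_g(x(a)) − 1` of output `g` on the base point. -/
def Dg (P : Fin (n + 1) → Smolensky.CubeFn (ZMod 3) (n + 1)) (a : Fin n → Bool) (g : Fin (n + 1)) : ZMod 3 :=
  P g (xOfU a) - 1

/-- the RESONANCE VALUE `rv_{gj}(a)`: the increment of `P_g` under the pair flip of window `j`. -/
def rv (P : Fin (n + 1) → Smolensky.CubeFn (ZMod 3) (n + 1)) (p : ℕ → ℕ) (a : Fin n → Bool) (g : Fin (n + 1))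
    (j : Fin F) : ZMod 3 :=
  P g (flip2 (xOfU a) (p j) (p j + 1)) - P g (xOfU a)

/-- the TEST ROW `m · rv_g + σ · path_g`. -/
def testRow (P : Fin (n + 1) → Smolensky.CubeFn (ZMod 3) (n + 1)) (p : ℕ → ℕ) (a : Fin n → Bool)
    (g : Fin (n + 1)) (σ m : ZMod 3) : Fin F → ZMod 3 :=
  fun j => m * rv P p a g j + pathRow p a g σ j

/-- number of RESONANT windows of the test row `(g, σ, m)`: its zero letters. -/
def Zcount (P : Fin (n + 1) → Smolensky.CubeFn (ZMod 3) (n + 1)) (p : ℕ → ℕ) (a : Fin n → Bool)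
    (g : Fin (n + 1)) (σ m : ZMod 3) : ℕ :=
  (univ.filter fun j : Fin F => testRow P p a g σ m j = 0).card

/-- Weight plus zero-count of a test row is the number of windows `F`. -/
theorem wt_add_Zcount (P : Fin (n + 1) → Smolensky.CubeFn (ZMod 3) (n + 1)) (p : ℕ → ℕ) (a : Fin n → Bool)
    (g : Fin (n + 1)) (σ m : ZMod 3) :
    AffBells37.wt (testRow (F := F) P p a g σ m) + Zcount (F := F) P p a g σ m = F := by
  unfold AffBells37.wt Zcount
  have h := Finset.card_filter_add_card_filter_not (s := (univ : Finset (Fin F)))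
    (fun j => testRow P p a g σ m j ≠ 0)
  simp only [not_not, card_univ, Fintype.card_fin] at h
  exact h

/-! ### The explicit character family of a slice -/

/-- `σ ∈ {1, 2}` coded by a Boolean. -/
def σv (σ : Bool) : ZMod 3 := if σ then 2 else 1

/-- `σv σ ∈ {1, 2}` is nonzero. -/
theorem σv_ne_zero (σ : Bool) : σv σ ≠ 0 := by cases σ <;> decide

/-- index of the family: bell `g`, Frobenius branch `σ`, and the kind — `inl 0` constant row,
`inl 1`/`inl 2` test rows `m = 1, 2`, `inr (j, side, part)` the `tGuess` rows. -/
abbrev Ix (n F : ℕ) : Type := Fin (n + 1) × Bool × (Fin 3 ⊕ (Fin F × Bool × Bool))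

/-- Cardinality of the index type: `|Ix n F| = (n+1)(6 + 8F)`. -/
theorem card_Ix (n F : ℕ) : Fintype.card (Ix n F) = (n + 1) * (6 + 8 * F) := by
  simp only [Ix, Fintype.card_prod, Fintype.card_sum, Fintype.card_bool, Fintype.card_fin]
  ring

/-- the target `x`-index of a `tGuess` side: `g` itself or `nxt g`. -/
def tgt (g : Fin (n + 1)) (side : Bool) : Fin (n + 1) := if side then nxt g else g

/-- the rows. -/
def rows (P : Fin (n + 1) → Smolensky.CubeFn (ZMod 3) (n + 1)) (p : ℕ → ℕ) (a : Fin n → Bool) :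
    Ix n F → Fin F → ZMod 3
  | (g, σ, Sum.inl k) => if k = 0 then pathRow p a g (σv σ) else testRow P p a g (σv σ) ((k.val : ℕ) : ZMod 3)
  | (g, σ, Sum.inr (j, _, part)) => pathRow p a g (σv σ) + (if part then Pi.single j 1 else 0)

/-- the coefficients. -/
def coefs (P : Fin (n + 1) → Smolensky.CubeFn (ZMod 3) (n + 1)) (p : ℕ → ℕ) (a : Fin n → Bool) : Ix n F → F4
  | (g, σ, Sum.inl k) =>
      if k = 0 then ωz (σv σ * Eg a g) * (1 + ιF (xOfU a g) + ιF (xOfU a (nxt g)))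
      else ωz (((k.val : ℕ) : ZMod 3) * Dg P a g + σv σ * Eg a g)
  | (g, σ, Sum.inr (j, side, _)) =>
      if ((tgt g side).val = p j ∨ (tgt g side).val = p j + 1) then ω * ωz (σv σ * Eg a g) else 0

/-- mass bookkeeping of the rows: constant rows weigh `F`, `tGuess` rows `≥ F − 1`, test rows `F − Z`. -/
theorem mass_rows_le (P : Fin (n + 1) → Smolensky.CubeFn (ZMod 3) (n + 1)) (p : ℕ → ℕ) (a : Fin n → Bool) :
    ∑ b : Ix n F, 2 ^ (F - AffBells37.wt (rows P p a b))
      ≤ 2 * (n + 1) * (1 + 8 * F) +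
        ∑ g : Fin (n + 1), ∑ σ : Bool, ∑ k : Fin 3,
          (if k = 0 then 0 else 2 ^ Zcount (F := F) P p a g (σv σ) ((k.val : ℕ) : ZMod 3)) := by
  have hsplit : ∑ b : Ix n F, (2 : ℕ) ^ (F - AffBells37.wt (rows P p a b))
      = ∑ g : Fin (n + 1), ∑ σ : Bool, ((∑ k : Fin 3, 2 ^ (F - AffBells37.wt (rows P p a ((g, σ, Sum.inl k) : Ix n F))))
          + ∑ t : Fin F × Bool × Bool, 2 ^ (F - AffBells37.wt (rows P p a ((g, σ, Sum.inr t) : Ix n F)))) := by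
    rw [Fintype.sum_prod_type]
    refine Fintype.sum_congr _ _ fun g => ?_
    rw [Fintype.sum_prod_type]
    refine Fintype.sum_congr _ _ fun σ => ?_
    rw [Fintype.sum_sum_type]
  rw [hsplit]
  have hinl : ∀ (g : Fin (n + 1)) (σ : Bool) (k : Fin 3), 2 ^ (F - AffBells37.wt (rows P p a ((g, σ, Sum.inl k) : Ix n F)))
      = (if k = 0 then 1 else 0) + (if k = 0 then 0 else 2 ^ Zcount (F := F) P p a g (σv σ) ((k.val : ℕ) : ZMod 3)) := by
    intro g σ k
    by_cases hk : k = 0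
    · simp only [rows, hk, if_true]
      rw [wt_pathRow p a g (σv_ne_zero σ), Nat.sub_self, pow_zero]
      rfl
    · simp only [rows, hk, if_false, Nat.zero_add]
      have h := wt_add_Zcount (F := F) P p a g (σv σ) ((k.val : ℕ) : ZMod 3)
      rw [show F - AffBells37.wt (testRow (F := F) P p a g (σv σ) ((k.val : ℕ) : ZMod 3))
          = Zcount (F := F) P p a g (σv σ) ((k.val : ℕ) : ZMod 3) by omega]
  have hinr : ∀ (g : Fin (n + 1)) (σ : Bool) (t : Fin F × Bool × Bool),
      2 ^ (F - AffBells37.wt (rows P p a ((g, σ, Sum.inr t) : Ix n F))) ≤ 2 := by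
    rintro g σ ⟨j, side, part⟩
    have hp := wt_pathRow p a g (σv_ne_zero σ) (F := F)
    cases part
    · simp only [rows, Bool.false_eq_true, if_false, add_zero]
      rw [hp, Nat.sub_self, pow_zero]; norm_num
    · simp only [rows, if_true]
      have h1 := wt_add_single_ge (pathRow p a g (σv σ)) j
      rw [hp] at h1
      calc 2 ^ (F - AffBells37.wt (pathRow p a g (σv σ) + Pi.single j (1 : ZMod 3)))
          ≤ 2 ^ 1 := Nat.pow_le_pow_right (by norm_num) (by omega)
        _ = 2 := by norm_num
  have hblock : ∀ (g : Fin (n + 1)) (σ : Bool),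
      ((∑ k : Fin 3, 2 ^ (F - AffBells37.wt (rows P p a ((g, σ, Sum.inl k) : Ix n F))))
        + ∑ t : Fin F × Bool × Bool, 2 ^ (F - AffBells37.wt (rows P p a ((g, σ, Sum.inr t) : Ix n F))))
      ≤ (1 + 8 * F) + ∑ k : Fin 3, (if k = 0 then 0 else 2 ^ Zcount (F := F) P p a g (σv σ) ((k.val : ℕ) : ZMod 3)) := by
    intro g σ
    have h1 : ∑ k : Fin 3, 2 ^ (F - AffBells37.wt (rows P p a ((g, σ, Sum.inl k) : Ix n F)))
        = 1 + ∑ k : Fin 3, (if k = 0 then 0 else 2 ^ Zcount (F := F) P p a g (σv σ) ((k.val : ℕ) : ZMod 3)) := by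
      rw [Fintype.sum_congr _ _ (hinl g σ), sum_add_distrib]
      norm_num [Fin.sum_univ_three]
    have h2 : ∑ t : Fin F × Bool × Bool, 2 ^ (F - AffBells37.wt (rows P p a ((g, σ, Sum.inr t) : Ix n F))) ≤ 8 * F := by
      calc ∑ t : Fin F × Bool × Bool, 2 ^ (F - AffBells37.wt (rows P p a ((g, σ, Sum.inr t) : Ix n F)))
          ≤ ∑ _t : Fin F × Bool × Bool, 2 := sum_le_sum fun t _ => hinr g σ t
        _ = 8 * F := by
          rw [sum_const, card_univ, smul_eq_mul, Fintype.card_prod, Fintype.card_prod, Fintype.card_bool,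
            Fintype.card_fin]
          ring
    rw [h1]
    omega
  calc ∑ g : Fin (n + 1), ∑ σ : Bool, ((∑ k : Fin 3, 2 ^ (F - AffBells37.wt (rows P p a ((g, σ, Sum.inl k) : Ix n F))))
          + ∑ t : Fin F × Bool × Bool, 2 ^ (F - AffBells37.wt (rows P p a ((g, σ, Sum.inr t) : Ix n F))))
      ≤ ∑ g : Fin (n + 1), ∑ σ : Bool,
          ((1 + 8 * F) + ∑ k : Fin 3, (if k = 0 then 0 else 2 ^ Zcount (F := F) P p a g (σv σ) ((k.val : ℕ) : ZMod 3))) :=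
        sum_le_sum fun g _ => sum_le_sum fun σ _ => hblock g σ
    _ = _ := by
        simp only [sum_add_distrib, sum_const, card_univ, Fintype.card_bool, Fintype.card_fin, smul_eq_mul]
        ring

/-! ### (E′) The slice expansion -/

/-- the unscaled path row. -/
def pathBase (p : ℕ → ℕ) (a : Fin n → Bool) (g : Fin (n + 1)) (j : Fin F) : ZMod 3 :=
  sg (uExt a (p j)) * (if p j < g.val then 2 else 1)

/-- The path row is `σ` times the path base. -/
theorem pathRow_eq (p : ℕ → ℕ) (a : Fin n → Bool) (g : Fin (n + 1)) (σ : ZMod 3) :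
    pathRow (F := F) p a g σ = fun j => σ * pathBase p a g j := rfl

/-- `lin` of the path row is `σ` times `lin` of the path base. -/
theorem lin_pathRow (p : ℕ → ℕ) (a : Fin n → Bool) (g : Fin (n + 1)) (σ : ZMod 3) (v : Fin F → Bool) :
    lin (pathRow p a g σ) v = σ * lin (pathBase p a g) v := by
  rw [pathRow_eq]; exact lin_mul σ (pathBase p a g) v

/-- the base factor of block `(g, σ)`: `ω^{σE_g} χ_{σ·path_g}`. -/
def Pσ (p : ℕ → ℕ) (a : Fin n → Bool) (g : Fin (n + 1)) (σ : Bool) (v : Fin F → Bool) : F4 :=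
  ωz (σv σ * Eg a g) * chiZ (pathRow p a g (σv σ)) v

/-- **LEMMA LAB**: the trace of the label on the slice splits into the two `σ`-blocks. -/
theorem tr_label_U {p : ℕ → ℕ} (hS : Sep n F p) (a : Fin n → Bool) (v : Fin F → Bool) (g : Fin (n + 1)) :
    tr (ω ^ (n + 2 + g.val + walkExp (U p a v) g.val)) = ∑ σ : Bool, Pσ p a g σ v := by
  rw [← ωz_natCast]
  have hN : ((n + 2 + g.val + walkExp (U p a v) g.val : ℕ) : ZMod 3) = Eg a g + lin (pathBase p a g) v := by
    push_cast
    rw [walkExp_U hS, lin_pathRow, one_mul]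
    unfold Eg
    push_cast
    ring
  rw [hN, Fintype.sum_bool]
  unfold Pσ tr
  rw [chiZ_eq_ωz, chiZ_eq_ωz, lin_pathRow, lin_pathRow, ← ωz_add, ← ωz_add, ωz_sq]
  simp only [σv, if_true, Bool.false_eq_true, if_false]
  rw [add_comm (ωz (Eg a g + lin (pathBase p a g) v))]
  congr 1 <;> congr 1 <;> ring

/-- the `k`-th bell character of window `g`. -/
def Bk (P : Fin (n + 1) → Smolensky.CubeFn (ZMod 3) (n + 1)) (p : ℕ → ℕ) (a : Fin n → Bool) (g : Fin (n + 1))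
    (k : Fin 3) (v : Fin F → Bool) : F4 :=
  ωz (((k.val : ℕ) : ZMod 3) * Dg P a g) * chiZ (fun j => ((k.val : ℕ) : ZMod 3) * rv P p a g j) v

/-- (E1) in `lin` form: `P_g` is affine on the slice with linear part `rv`. -/
theorem P_U {p : ℕ → ℕ} (P : Fin (n + 1) → Smolensky.CubeFn (ZMod 3) (n + 1)) (g : Fin (n + 1))
    (hSA : SA (n := n) p F (P g)) (a : Fin n → Bool) (v : Fin F → Bool) :
    P g (xOfU (U p a v)) = P g (xOfU a) + lin (rv P p a g) v := by
  rw [hSA a v]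
  unfold lin rv
  congr 1
  refine sum_congr rfl fun j _ => ?_
  unfold bt
  by_cases hv : v j = true
  · rw [if_pos hv, if_pos hv, mul_one]
  · rw [if_neg hv, if_neg hv, mul_zero]

/-- **LEMMA BELL**: on the slice the output bit is the average of three characters. -/
theorem ιF_zOf_U {p : ℕ → ℕ} (P : Fin (n + 1) → Smolensky.CubeFn (ZMod 3) (n + 1)) (g : Fin (n + 1))
    (hSA : SA (n := n) p F (P g)) (a : Fin n → Bool) (v : Fin F → Bool) :
    ιF (zOf P (xOfU (U p a v)) g) = ∑ k : Fin 3, Bk P p a g k v := by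
  unfold zOf
  rw [AffBells37.ιF_decide_eq, P_U P g hSA]
  refine Fintype.sum_congr _ _ fun k => ?_
  unfold Bk Dg
  rw [chiZ_eq_ωz, lin_mul, ← ωz_add]
  congr 1; ring

/-- the slice-expanded coordinate `ι(x_i(U a v))` as a function of `v`. -/
def Gx (p : ℕ → ℕ) (a : Fin n → Bool) (v : Fin F → Bool) (i : Fin (n + 1)) : F4 :=
  ιF (xOfU a i) + ∑ j : Fin F, (if (i.val = p j ∨ i.val = p j + 1) then ω * (1 + ωz (if v j then 1 else 0)) else 0)

/-- The walk bit `x_i(U p a v)` in `F4` equals the explicit expression `Gx p a v i`. -/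
theorem ιF_xOfU_U' {p : ℕ → ℕ} (hS : Sep n F p) (a : Fin n → Bool) (v : Fin F → Bool) (i : Fin (n + 1)) :
    ιF (xOfU (U p a v) i) = Gx p a v i := by
  rw [ιF_xOfU_U hS]
  unfold Gx
  congr 1
  refine Fintype.sum_congr _ _ fun j => ?_
  by_cases h : i.val = p j ∨ i.val = p j + 1
  · rw [if_pos h, if_pos h, ιF_eq_omega]
  · rw [if_neg h, if_neg h]

/-- **LEMMA Y**: the strategy bit on the slice. -/
theorem ιF_yOf_U {p : ℕ → ℕ} (hS : Sep n F p) (P : Fin (n + 1) → Smolensky.CubeFn (ZMod 3) (n + 1))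
    (g : Fin (n + 1)) (hSA : SA (n := n) p F (P g)) (a : Fin n → Bool) (v : Fin F → Bool) :
    ιF (yOf P g (U p a v)) = (∑ k : Fin 3, Bk P p a g k v) + (Gx p a v g + Gx p a v (nxt g)) := by
  unfold yOf tGuess
  rw [ιF_xor, ιF_xor, ιF_zOf_U P g hSA, ιF_xOfU_U' hS, ιF_xOfU_U' hS]

/-- **LEMMA BLOCK**: the rows and coefficients of block `(g, σ)` sum to `P_σ · ι(y_g)`-slice-part. -/
theorem block (P : Fin (n + 1) → Smolensky.CubeFn (ZMod 3) (n + 1)) (p : ℕ → ℕ) (a : Fin n → Bool)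
    (v : Fin F → Bool) (g : Fin (n + 1)) (σ : Bool) :
    (∑ k : Fin 3, coefs P p a ((g, σ, Sum.inl k) : Ix n F) * chiZ (rows P p a ((g, σ, Sum.inl k) : Ix n F)) v)
      + ∑ t : Fin F × Bool × Bool, coefs P p a ((g, σ, Sum.inr t) : Ix n F) * chiZ (rows P p a ((g, σ, Sum.inr t) : Ix n F)) v
      = Pσ p a g σ v * ((∑ k : Fin 3, Bk P p a g k v) + (Gx p a v g + Gx p a v (nxt g))) := by
  have hinl : ∀ k : Fin 3, coefs P p a ((g, σ, Sum.inl k) : Ix n F) * chiZ (rows P p a ((g, σ, Sum.inl k) : Ix n F)) v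
      = Pσ p a g σ v * Bk P p a g k v
        + (if k = 0 then Pσ p a g σ v * (ιF (xOfU a g) + ιF (xOfU a (nxt g))) else 0) := by
    intro k
    by_cases hk : k = 0
    · subst hk
      simp only [coefs, rows, if_true]
      unfold Pσ Bk
      have h0 : chiZ (fun j => (((0 : Fin 3).val : ℕ) : ZMod 3) * rv P p a g j) v = 1 := by
        rw [chiZ_eq_ωz]; unfold lin; simp [ωz_zero]
      rw [h0, Fin.val_zero, Nat.cast_zero, zero_mul, ωz_zero]
      ring
    · simp only [coefs, rows, hk, if_false]
      unfold Pσ Bk testRow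
      rw [chiZ_eq_ωz, chiZ_eq_ωz, chiZ_eq_ωz, ωz_add]
      have hl : lin (fun j => ((k.val : ℕ) : ZMod 3) * rv P p a g j + pathRow p a g (σv σ) j) v
          = lin (fun j => ((k.val : ℕ) : ZMod 3) * rv P p a g j) v + lin (pathRow p a g (σv σ)) v := by
        rw [← lin_add]; rfl
      rw [hl, ωz_add, add_zero]
      ring
  have hinr : ∀ j : Fin F, ∀ side : Bool,
      ∑ part : Bool, coefs P p a ((g, σ, Sum.inr (j, side, part)) : Ix n F) * chiZ (rows P p a ((g, σ, Sum.inr (j, side, part)) : Ix n F)) v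
        = Pσ p a g σ v * (if ((tgt g side).val = p j ∨ (tgt g side).val = p j + 1)
            then ω * (1 + ωz (if v j then 1 else 0)) else 0) := by
    intro j side
    rw [Fintype.sum_bool]
    simp only [coefs, rows, if_true, Bool.false_eq_true, if_false, add_zero]
    by_cases hc : (tgt g side).val = p j ∨ (tgt g side).val = p j + 1
    · simp only [if_pos hc]
      unfold Pσ
      rw [chiZ_eq_ωz, chiZ_eq_ωz, lin_add, lin_single, ωz_add]
      ring
    · simp only [if_neg hc]
      ring
  have hinr' : ∑ t : Fin F × Bool × Bool, coefs P p a ((g, σ, Sum.inr t) : Ix n F) * chiZ (rows P p a ((g, σ, Sum.inr t) : Ix n F)) v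
      = ∑ j : Fin F,
          (Pσ p a g σ v * (if ((nxt g).val = p j ∨ (nxt g).val = p j + 1) then ω * (1 + ωz (if v j then 1 else 0)) else 0)
          + Pσ p a g σ v * (if (g.val = p j ∨ g.val = p j + 1) then ω * (1 + ωz (if v j then 1 else 0)) else 0)) := by
    rw [Fintype.sum_prod_type]
    refine Fintype.sum_congr _ _ fun j => ?_
    rw [Fintype.sum_prod_type, Fintype.sum_bool, hinr, hinr]
    simp only [tgt, if_true, Bool.false_eq_true, if_false]
  have h3 : ∑ k : Fin 3, (if k = 0 then Pσ p a g σ v * (ιF (xOfU a g) + ιF (xOfU a (nxt g))) else 0)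
      = Pσ p a g σ v * (ιF (xOfU a g) + ιF (xOfU a (nxt g))) := by
    rw [Fin.sum_univ_three, if_pos rfl, if_neg (by decide), if_neg (by decide), add_zero, add_zero]
  rw [Fintype.sum_congr _ _ hinl, sum_add_distrib, h3, hinr', sum_add_distrib, ← mul_sum, ← mul_sum, ← mul_sum]
  unfold Gx
  ring

/-- **(E′) THE SLICE EXPANSION** for slice-affine polynomial strategies. -/
theorem sliceExpansion {p : ℕ → ℕ} (hS : Sep n F p) (P : Fin (n + 1) → Smolensky.CubeFn (ZMod 3) (n + 1))
    (hSA : ∀ g, SA (n := n) p F (P g)) (a : Fin n → Bool) (v : Fin F → Bool) :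
    ιF (Wn P (U p a v)) = ev univ (rows P p a) (coefs P p a) v := by
  unfold Wn
  rw [ιF_ringWinU]
  unfold ev
  rw [Fintype.sum_prod_type]
  refine Fintype.sum_congr _ _ fun g => ?_
  rw [ιF_yOf_U hS P g (hSA g), tr_label_U hS, Fintype.sum_prod_type, mul_sum]
  refine Fintype.sum_congr _ _ fun σ => ?_
  rw [Fintype.sum_sum_type, block]
  exact mul_comm _ _


end Slicing

end Summit.QuantumAdvantage.AdviceFreeQNC0.NPGamma37Proof
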